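/-
Copyright (c) 2026 the pub-hodgecm-mathlib formalisation cell (harness21).  Prover seat hodgecm-mathlib-LH7-p05 (g0), req620 Track A «(D-RAM) FOUR-FRAME» squad, helper lane on
h413 = stmt-HodgeConjecture-24833 (count-neutral).  β-BOARD v1 row R7 «GLUE CLASSES», Theorem C infrastructure (SIG-R7-GlueClasses v1 c4b08d36 §5).  2026-09-04.
-/
import Summits.HodgeConjecture.HodgeConjecture.Theorems.F0P3cDyRamDiagonalKappaGluedDecomposition   -- ★ κG-C1 (LH4-p09): the κ orbit decomposition of the glued family; brings ★ (iv-a) orbit lemmas, ★ (iv-b-idx), ★ κG-A1, ★ StratumTools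
import Summits.HodgeConjecture.HodgeConjecture.Theorems.F0P3cDyRamLabelledOddCountDefs                 -- ★ DEFS (LH4-p11 (g8)): `polarisationNormClasses`, `classLabelSign`, `labelledOddCount`, `IsTorusEquivariantLabel`
import HarnessLib

/-!
# Crux `H413`, line LH4 «(D-RAM) FOUR-FRAME» — (β) Stage B, β-BOARD rows R3–R8 shared infrastructure: THE LABELLED ODD COUNT IS A UNIT-TORUS ORBIT INVARIANT, and
# THE LABELLED-ODD TABLE OF THE GLUED FAMILY `G₁(2ρ, 2t)` CUT BY ANY ORBIT-STABLE PREDICATE DECOMPOSES OVER THE CLASS REPRESENTATIVES `latt V(1,1,g)`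

Cell `hodgecm-mathlib` (D-0151), FLOOR 0, crux item H413 = `stmt-HodgeConjecture-24833`, route `HCCMUnconditional`; squad F0∕P3c∕LH4 (β-table fan, sub-dealer LH4-p05 (g8)).
THEOREMS ONLY (no `def`, no instance, no notation, no `sorry`, default heartbeats); ★-only imports; lane `--supports stmt-HodgeConjecture-24833 --as helper` (count-neutral);
pays NO row, states NO law.  The labelled twin of ★ κG-C1 `F0P3cDyRamDiagonalKappaGluedDecomposition.finsum_kappaCount_mul_stabiliserWeight_glued_eq` (LH4-p09): there the
summand is `κ_i(M)·w(M)`, here it is the β-TABLE's summand `labelledOddCount σ ϖ tv i Λ M ∕ [𝒰 : N(S̃(M))]` restricted to an orbit-stable cut `P` (the clean shell of the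
consumer).  Consumers: R7 Theorem C (LH7-p05, the glue classes on the foot), and any β-BOARD row that evaluates the labelled table of a glued stratum orbit by orbit (R3–R5
boundary layers, R8 at `t = 0` after its own normal form).

THE MATHEMATICS ([Kottwitz1986BaseChangeUnits, §1]; [LanglandsShelstad1987, §3]).
* §1 `polarisationNormClasses_mapGL_diagGLUnits` — the classes of `diag(z)·M` modulo `N(S̃)` are the `N(z)⁻¹`-translates of those of `M` (★ `isVertexLattice_diagonal_mapGL_diagGLUnits_iff`,
  ★ `unitStabilizer_mapGL_diagGLUnits`); `classLabelSign_image_mul_norm_of_equivariant` — for a torus-EQUIVARIANT label `Λ` (★ `IsTorusEquivariantLabel`) the signed label of the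
  translated class read at `diag(z)·M` is the signed label of the class read at `M` (`ω` is blind to norms, ★ `normSign_mul_norm`); HEAD `labelledOddCount_mapGL_diagGLUnits` —
  `labelledOddCount σ ϖ tv i Λ (diag(z)·M) = labelledOddCount σ ϖ tv i Λ M` for every `z ∈ (K^×)³`.
* §2 HEAD `finsum_labelledOdd_div_relIndex_glued_sep_eq` — for `T = diag(s)` a unit diagonal, `ρ, t ≥ 1`, a complete irredundant system `R` of the fixed elements of valuation
  `|ϖ|^{2t}` modulo `𝔭^{ρ+2t}`, reference frames `V₀ g = V(1,1,g)`, a torus-equivariant label `Λ` and a unit-torus-stable predicate `P`: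
  `Σᶠ_{M glued, T-stable, dualisable, P M} labelledOddCount σ ϖ tv i Λ M ∕ [𝒰 : N(S̃(M))] = |𝒯-orbit| · Σ_{g ∈ R, latt V₀(g) T-stable, P (latt V₀ g)} (the same summand at latt V₀(g))`,
  `|𝒯-orbit| = ((q−1)q^{ρ+2t−1})((q−1)q^{2ρ−1})` (★ (iv-b-idx)) — ★ κG-C1's orbit–stabiliser route with the cut `P` carried along the orbits (both `labelledOddCount` and the index
  `[𝒰 : N(S̃(M))]` are orbit constants: §1 and ★ `unitStabilizer_mapGL_diagGLUnits`).
HONEST LABEL: count-neutral bookkeeping; nothing summed to a value; R7 ∕ hRest ∕ (β-BAL) ∕ (β) ∕ T₊ OPEN; `HC_CM` is proved only modulo the 7 printed citations (2 remaining named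
inputs: hLiu418 = `stmt-HodgeConjecture-24832`, h413 = `stmt-HodgeConjecture-24833`) until rung 0 closes.
References: [Kottwitz1986BaseChangeUnits] §1 pp. 240–241 · [LanglandsShelstad1987] §3 · [Rogawski1990] §4.9 Prop. 4.9.1 (a)(b) p. 55 · [Serre1979] Ch. V §3 Cor. 3.
-/

set_option autoImplicit false

noncomputable section

namespace Summit.HodgeConjecture.HodgeConjecture.Cruxes.H413.F0P3cDyRamLabelledOddGluedDecomposition

open Matrix WithZero
open Literature.NumberTheory.Automorphic Literature.NumberTheory.Automorphic.HermitianLattice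
open Literature.NumberTheory.Automorphic.UnitaryLatticeTree Literature.NumberTheory.Automorphic.UnitaryThreeFourFrame
open Summit.HodgeConjecture.HodgeConjecture.Cruxes.H413.F0P3cDyRamDiagonalTorusDefs
open Summit.HodgeConjecture.HodgeConjecture.Cruxes.H413.F0P3cDyRamLabelledOddCountDefs
open Summit.HodgeConjecture.HodgeConjecture.Cruxes.H413.F0P3cDyRamDiagonalGluedTorusOrbits
open Summit.HodgeConjecture.HodgeConjecture.Cruxes.H413.F0P3cDyRamDiagonalGluedStabiliserIndex (ne_zero_and_v_lt_one_of_v_eq_exp)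
open Summit.HodgeConjecture.HodgeConjecture.Cruxes.H413.F0P3cDyRamDiagonalGluedStabiliserIndexFull (ncard_unitTorus_orbit_latt_glued_eq)
open Summit.HodgeConjecture.HodgeConjecture.Cruxes.H413.F0P3cDyRamDiagonalPairReindex (mapGL_mapGL_diagGLUnits_eq_iff)
open Summit.HodgeConjecture.HodgeConjecture.Cruxes.H413.F0P3cDyRamDiagonalStratumTools (finsum_mem_eq_ncard_mul unitStabilizer_mapGL_diagGLUnits)
open Summit.HodgeConjecture.HodgeConjecture.Cruxes.H413.F0P3cDyRamDiagonalOrbitFibreTransport (isVertexLattice_diagonal_mapGL_diagGLUnits_iff)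
open Summit.HodgeConjecture.HodgeConjecture.Cruxes.H413.F0P3cDyRamFixedCountDiagonalModel (normSign_mul_norm)
open scoped Valued WithZero Matrix MatrixGroups

variable {K : Type} [Field K] [Valued K ℤᵐ⁰]

/-! ## §1  The labelled odd count is constant along `(K^×)³`-orbits -/

omit [Valued K ℤᵐ⁰] in
/-- The translate of the class `D·N′` (`N′` any subgroup of the torus, slotwise `D ↦ D·w`) is the class `(D·w)·N′`. [cite: Kottwitz1986BaseChangeUnits, §1 pp. 240–241] -/
theorem image_mul_normClass_eq (NS : Subgroup (Fin 3 → Kˣ)) (D w : Fin 3 → K) :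
    (fun E : Fin 3 → K => fun j => E j * w j) '' {E : Fin 3 → K | ∃ n ∈ NS, ∀ j, E j = D j * ((n j : Kˣ) : K)} =
      {E : Fin 3 → K | ∃ n ∈ NS, ∀ j, E j = (D j * w j) * ((n j : Kˣ) : K)} := by
  ext E
  simp only [Set.mem_image, Set.mem_setOf_eq]
  constructor
  · rintro ⟨E', ⟨u, hu, hE'⟩, rfl⟩
    exact ⟨u, hu, fun j => by show E' j * w j = _; rw [hE' j]; ring⟩
  · rintro ⟨u, hu, hE⟩
    exact ⟨fun j => D j * ((u j : Kˣ) : K), ⟨u, hu, fun j => rfl⟩, funext fun j => by rw [hE j]; ring⟩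

/-- **THE POLARISATION CLASSES OF `diag(z)·M` MODULO `N(S̃)` ARE THE `N(z)⁻¹`-TRANSLATES OF THOSE OF `M`** (`σ` an involution; any vertex type): `D′` polarises `diag(z)·M` iff
`D′·N(z)` polarises `M` (★ `isVertexLattice_diagonal_mapGL_diagGLUnits_iff`), and `S̃(diag(z)·M) = S̃(M)` (★ `unitStabilizer_mapGL_diagGLUnits`).
[cite: Kottwitz1986BaseChangeUnits, §1 pp. 240–241] -/
theorem polarisationNormClasses_mapGL_diagGLUnits {σ : K →+* K} (hσ : ∀ a, σ (σ a) = a) (ϖ : K) (tv : ℕ) (z : Fin 3 → Kˣ) (M : Submodule 𝒪[K] (Fin 3 → K)) :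
    polarisationNormClasses σ ϖ tv (mapGL (diagGLUnits z) M) =
      (fun C : Set (Fin 3 → K) => (fun E : Fin 3 → K => fun j => E j * (((z j : K))⁻¹ * σ ((z j : K))⁻¹)) '' C) '' polarisationNormClasses σ ϖ tv M := by
  have hz : ∀ j, ((z j : Kˣ) : K) ≠ 0 := fun j => (z j).ne_zero
  have hN : ∀ j, ((z j : K) * σ (z j)) * (((z j : K))⁻¹ * σ ((z j : K))⁻¹) = 1 := fun j => by
    rw [map_inv₀]; field_simp
  have hσN : ∀ j, σ (((z j : K))⁻¹ * σ ((z j : K))⁻¹) = ((z j : K))⁻¹ * σ ((z j : K))⁻¹ := fun j => by rw [map_mul, hσ, mul_comm]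
  have hN0 : ∀ j, ((z j : K))⁻¹ * σ ((z j : K))⁻¹ ≠ 0 := fun j =>
    mul_ne_zero (inv_ne_zero (hz j)) ((map_ne_zero σ).2 (inv_ne_zero (hz j)))
  rw [polarisationNormClasses, polarisationNormClasses, unitStabilizer_mapGL_diagGLUnits]
  ext C'
  simp only [Set.mem_setOf_eq, Set.mem_image]
  constructor
  · rintro ⟨D', ⟨hD', hV'⟩, rfl⟩
    -- `D := D′·N(z)` polarises `M`
    refine ⟨{E | ∃ u ∈ (unitStabilizer M).map (unitNormMap σ 3), ∀ j, E j = (D' j * ((z j : K) * σ (z j))) * ((u j : Kˣ) : K)},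
      ⟨fun j => D' j * ((z j : K) * σ (z j)), ⟨fun j => ⟨?_, ?_⟩, (isVertexLattice_diagonal_mapGL_diagGLUnits_iff σ ϖ D' z tv M).1 hV'⟩, rfl⟩, ?_⟩
    · rw [map_mul, (hD' j).1, map_mul, hσ, mul_comm (σ (z j : K))]
    · exact mul_ne_zero (hD' j).2 (mul_ne_zero (hz j) ((map_ne_zero σ).2 (hz j)))
    · rw [image_mul_normClass_eq]
      ext E
      simp only [Set.mem_setOf_eq]
      refine exists_congr fun u => and_congr_right fun _ => forall_congr' fun j => ?_
      rw [mul_assoc (D' j), hN j, mul_one]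
  · rintro ⟨C, ⟨D, ⟨hD, hV⟩, rfl⟩, rfl⟩
    refine ⟨fun j => D j * (((z j : K))⁻¹ * σ ((z j : K))⁻¹), ⟨fun j => ⟨?_, ?_⟩, ?_⟩, ?_⟩
    · rw [map_mul, (hD j).1, hσN j]
    · exact mul_ne_zero (hD j).2 (hN0 j)
    · have e : (fun i => D i * (((z i : K))⁻¹ * σ ((z i : K))⁻¹) * ((z i : K) * σ (z i))) = D :=
        funext fun j => by rw [mul_assoc, mul_comm (((z j : K))⁻¹ * σ ((z j : K))⁻¹), hN j, mul_one]
      have h := (isVertexLattice_diagonal_mapGL_diagGLUnits_iff σ ϖ (fun j => D j * (((z j : K))⁻¹ * σ ((z j : K))⁻¹)) z tv M).2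
      simp only [e] at h
      exact h hV
    · rw [image_mul_normClass_eq]

open Classical in
/-- **A TORUS-EQUIVARIANT LABEL READS THE TRANSLATED CLASS AT THE TRANSLATED LATTICE AS IT READS THE CLASS AT THE LATTICE**: for `Λ` with `Λ(diag(z)M, D) ↔ Λ(M, D·N(z))`,
`classLabelSign σ i (Λ (diag(z)·M)) (C·N(z)⁻¹) = classLabelSign σ i (Λ M) C` (`ω(D_i·N((z_i)⁻¹)) = ω(D_i)`, ★ `normSign_mul_norm`). [cite: LanglandsShelstad1987, §3]
[cite: Kottwitz1986BaseChangeUnits, §1 pp. 240–241] -/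
theorem classLabelSign_image_mul_norm_of_equivariant (σ : K →+* K) {Λ : Submodule 𝒪[K] (Fin 3 → K) → (Fin 3 → K) → Prop} (hΛ : IsTorusEquivariantLabel σ Λ)
    (i : Fin 3) (z : Fin 3 → Kˣ) (M : Submodule 𝒪[K] (Fin 3 → K)) (C : Set (Fin 3 → K)) :
    classLabelSign σ i (Λ (mapGL (diagGLUnits z) M)) ((fun E : Fin 3 → K => fun j => E j * (((z j : K))⁻¹ * σ ((z j : K))⁻¹)) '' C) =
      classLabelSign σ i (Λ M) C := by
  have hz : ∀ j, ((z j : Kˣ) : K) ≠ 0 := fun j => (z j).ne_zero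
  have hN : ∀ j, (((z j : K))⁻¹ * σ ((z j : K))⁻¹) * ((z j : K) * σ (z j)) = 1 := fun j => by
    rw [map_inv₀]; field_simp
  -- the label: equivariance
  have hlab : ∀ E : Fin 3 → K, Λ (mapGL (diagGLUnits z) M) (fun j => E j * (((z j : K))⁻¹ * σ ((z j : K))⁻¹)) ↔ Λ M E := by
    intro E
    rw [hΛ z M]
    have e : (fun j => E j * (((z j : K))⁻¹ * σ ((z j : K))⁻¹) * (((z j : Kˣ) : K) * σ ((z j : Kˣ) : K))) = E :=
      funext fun j => by rw [mul_assoc, hN j, mul_one]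
    rw [e]
  -- the sign: `ω` is blind to the norm `N((z_i)⁻¹)`
  have hsgn : ∀ E : Fin 3 → K, normSign σ (E i * (((z i : K))⁻¹ * σ ((z i : K))⁻¹)) = normSign σ (E i) := fun E =>
    normSign_mul_norm σ (E i) (inv_ne_zero (hz i))
  have hiff : ∀ a : ℤ, (∀ D ∈ (fun E : Fin 3 → K => fun j => E j * (((z j : K))⁻¹ * σ ((z j : K))⁻¹)) '' C,
      Λ (mapGL (diagGLUnits z) M) D ∧ normSign σ (D i) = a) ↔ ∀ D ∈ C, Λ M D ∧ normSign σ (D i) = a := by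
    intro a
    constructor
    · intro h D hD
      have h' := h _ ⟨D, hD, rfl⟩
      rw [hlab D, hsgn D] at h'
      exact h'
    · rintro h _ ⟨D, hD, rfl⟩
      rw [hlab D, hsgn D]
      exact h D hD
  rw [classLabelSign_eq, classLabelSign_eq]
  exact if_congr (hiff 1) rfl (if_congr (hiff (-1)) rfl rfl)

/-- **HEAD §1 — `labelledOddCount σ ϖ tv i Λ` IS CONSTANT ON `(K^×)³`-ORBITS** for a torus-equivariant label `Λ` (`σ` an involution): `labelledOddCount (diag(z)·M) = labelledOddCount M`.
(So along a unit-torus orbit the β-TABLE summand `labelledOddCount ∕ [𝒰 : N(S̃)]` is constant — §2.)  The labelled twin of ★ κG-A1 `kappaCount_mapGL_diagGLUnits`.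
[cite: Kottwitz1986BaseChangeUnits, §1 pp. 240–241] [cite: LanglandsShelstad1987, §3] -/
theorem labelledOddCount_mapGL_diagGLUnits {σ : K →+* K} (hσ : ∀ a, σ (σ a) = a) (ϖ : K) (tv : ℕ) (i : Fin 3)
    {Λ : Submodule 𝒪[K] (Fin 3 → K) → (Fin 3 → K) → Prop} (hΛ : IsTorusEquivariantLabel σ Λ) (z : Fin 3 → Kˣ) (M : Submodule 𝒪[K] (Fin 3 → K)) :
    labelledOddCount σ ϖ tv i Λ (mapGL (diagGLUnits z) M) = labelledOddCount σ ϖ tv i Λ M := by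
  have hz : ∀ j, ((z j : K))⁻¹ ≠ 0 := fun j => inv_ne_zero (z j).ne_zero
  set τ : (Fin 3 → K) → (Fin 3 → K) := fun E j => E j * (((z j : K))⁻¹ * σ ((z j : K))⁻¹) with hτ
  have hτinj : Function.Injective τ := by
    intro E E' h
    funext j
    have hj := congrFun h j
    simp only [hτ] at hj
    exact mul_right_cancel₀ (mul_ne_zero (hz j) ((map_ne_zero σ).2 (hz j))) hj
  have himg : Function.Injective (Set.image τ) := Set.image_injective.2 hτinj
  rw [labelledOddCount_eq, labelledOddCount_eq, polarisationNormClasses_mapGL_diagGLUnits hσ ϖ tv z M, finsum_mem_image himg.injOn]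
  exact finsum_mem_congr rfl fun C _ => classLabelSign_image_mul_norm_of_equivariant σ hΛ i z M C

/-! ## §2  The labelled-odd table of the glued family, cut by an orbit-stable predicate, decomposed over the class representatives -/

open Classical in
/-- **HEAD §2 — THE LABELLED-ODD TABLE OF THE GLUED STABLE DUALISABLE FAMILY `G₁(2ρ, 2t)` CUT BY `P`, BY CLASSES**: for `T = diag(s)` a unit diagonal (no regime assumption),
`σ` an isometric involution, `0 < |ϖ| < 1`, the trace bound, `ρ, t ≥ 1`, a complete irredundant system `R` (Finset) of the fixed elements of valuation
`|ϖ|^{2t}` modulo `𝔭^{ρ+2t}`, reference frames `V₀ g = V(1, 1, g)`, a torus-equivariant label `Λ` and a predicate `P` stable under the unit torus: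
`Σᶠ_{M ∈ {latt V(x,ζ,y″) : T·M = M, dualisable} ∧ P M} labelledOddCount σ ϖ tv i Λ M ∕ [𝒰 : N(S̃(M))] =
((q−1)q^{ρ+2t−1})·((q−1)q^{2ρ−1}) · Σ_{g ∈ R, T·latt V₀(g) = latt V₀(g), P (latt V₀ g)} labelledOddCount σ ϖ tv i Λ (latt V₀ g) ∕ [𝒰 : N(S̃(latt V₀ g))]` — the family is the
disjoint union of the orbits of the STABLE representatives (★ (iv-a), ★ `mapGL_mapGL_diagGLUnits_eq_iff`), `P` is constant along orbits by hypothesis, and so are the labelled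
count (§1) and the index (★ `unitStabilizer_mapGL_diagGLUnits`); `|orbit|` by ★ (iv-b-idx). [cite: Kottwitz1986BaseChangeUnits, §1 pp. 240–241] [cite: LanglandsShelstad1987, §3]
[cite: Rogawski1990, §4.9 Prop. 4.9.1 (a)(b) p. 55] -/
theorem finsum_labelledOdd_div_relIndex_glued_sep_eq {σ : K →+* K} (hσ : ∀ a, σ (σ a) = a) (hvσ : ∀ a, Valued.v (σ a) = Valued.v a)
    {ϖ : K} (hϖ : Valued.v ϖ = exp (-1 : ℤ))
    [Finite 𝓀[K]] (hTr : ∀ a : K, Valued.v (a + σ a) ≤ Valued.v ϖ * Valued.v a)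
    {s : Fin 3 → K} (T : GL (Fin 3) K) (hT : (T : Matrix (Fin 3) (Fin 3) K) = Matrix.diagonal s)
    (ρ t : ℕ) (hρ : 1 ≤ ρ) (ht : 1 ≤ t) (R : Finset K) (hR1 : ∀ g ∈ R, σ g = g ∧ Valued.v g = Valued.v ϖ ^ (2 * t))
    (hR2 : ∀ f : K, σ f = f → Valued.v f = Valued.v ϖ ^ (2 * t) → ∃ g ∈ R, Valued.v (f - g) ≤ Valued.v ϖ ^ (ρ + 2 * t))
    (hR3 : ∀ g ∈ R, ∀ g' ∈ R, Valued.v (g - g') ≤ Valued.v ϖ ^ (ρ + 2 * t) → g = g')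
    (V₀ : K → GL (Fin 3) K) (hV₀ : ∀ g, (V₀ g : Matrix (Fin 3) (Fin 3) K) = !![1, 0, 0; 1, ϖ ^ ρ, 0; 1 * 1 + g, ϖ ^ ρ * 1, ϖ ^ (2 * ρ + 2 * t)])
    (tv : ℕ) (i : Fin 3) {Λ : Submodule 𝒪[K] (Fin 3 → K) → (Fin 3 → K) → Prop} (hΛ : IsTorusEquivariantLabel σ Λ)
    (P : Submodule 𝒪[K] (Fin 3 → K) → Prop) (hP : ∀ u ∈ unitTorus K 3, ∀ M : Submodule 𝒪[K] (Fin 3 → K), P (mapGL (diagGLUnits u) M) ↔ P M) :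
    ∑ᶠ M ∈ {M : Submodule 𝒪[K] (Fin 3 → K) | M ∈ {M : Submodule 𝒪[K] (Fin 3 → K) | ∃ x ζ y'' : K, Valued.v x = 1 ∧ Valued.v ζ = 1 ∧ Valued.v y'' = Valued.v ϖ ^ (2 * t) ∧
        M = latt (!![1, 0, 0; x, ϖ ^ ρ, 0; x * ζ + y'', ϖ ^ ρ * ζ, ϖ ^ (2 * ρ + 2 * t)] : Matrix (Fin 3) (Fin 3) K) ∧ mapGL T M = M ∧ IsDualisableLattice σ ϖ M} ∧ P M},
        (labelledOddCount σ ϖ tv i Λ M : ℚ) / ((((unitStabilizer M).map (unitNormMap σ 3)).relIndex (fixedUnitTorus σ 3) : ℕ) : ℚ) =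
      ((((Nat.card 𝓀[K] - 1) * Nat.card 𝓀[K] ^ (ρ + 2 * t - 1)) * ((Nat.card 𝓀[K] - 1) * Nat.card 𝓀[K] ^ (2 * ρ - 1)) : ℕ) : ℚ) *
        ∑ g ∈ R.filter (fun g => mapGL T (latt (V₀ g : Matrix (Fin 3) (Fin 3) K)) = latt (V₀ g : Matrix (Fin 3) (Fin 3) K) ∧ P (latt (V₀ g : Matrix (Fin 3) (Fin 3) K))),
          (labelledOddCount σ ϖ tv i Λ (latt (V₀ g : Matrix (Fin 3) (Fin 3) K)) : ℚ) /
            ((((unitStabilizer (latt (V₀ g : Matrix (Fin 3) (Fin 3) K))).map (unitNormMap σ 3)).relIndex (fixedUnitTorus σ 3) : ℕ) : ℚ) := by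
  obtain ⟨hϖ0, hϖ1⟩ := ne_zero_and_v_lt_one_of_v_eq_exp hϖ
  set Orb : K → Set (Submodule 𝒪[K] (Fin 3 → K)) := fun g => {M | ∃ u ∈ unitTorus K 3, M = mapGL (diagGLUnits u) (latt (V₀ g : Matrix (Fin 3) (Fin 3) K))}
    with hOrb
  set R' : Finset K := R.filter (fun g => mapGL T (latt (V₀ g : Matrix (Fin 3) (Fin 3) K)) = latt (V₀ g : Matrix (Fin 3) (Fin 3) K) ∧
    P (latt (V₀ g : Matrix (Fin 3) (Fin 3) K))) with hR'
  have hvg : ∀ g ∈ R, Valued.v g < 1 := fun g hg => by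
    rw [(hR1 g hg).2]; exact pow_lt_one₀ zero_le hϖ1 (by omega)
  have hlt : Valued.v ϖ ^ (ρ + 2 * t) < Valued.v ϖ ^ (2 * t) := by
    rw [pow_add, mul_comm]
    exact mul_lt_of_lt_one_right (pow_pos ((Valuation.pos_iff _).2 hϖ0) _) (pow_lt_one₀ zero_le hϖ1 (by omega))
  have h11 : Valued.v (1 : K) = 1 := map_one _
  -- the set identity: the cut family is the union of the orbits of the STABLE representatives IN THE CUT
  have hset : {M : Submodule 𝒪[K] (Fin 3 → K) | M ∈ {M : Submodule 𝒪[K] (Fin 3 → K) | ∃ x ζ y'' : K, Valued.v x = 1 ∧ Valued.v ζ = 1 ∧ Valued.v y'' = Valued.v ϖ ^ (2 * t) ∧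
        M = latt (!![1, 0, 0; x, ϖ ^ ρ, 0; x * ζ + y'', ϖ ^ ρ * ζ, ϖ ^ (2 * ρ + 2 * t)] : Matrix (Fin 3) (Fin 3) K) ∧ mapGL T M = M ∧
        IsDualisableLattice σ ϖ M} ∧ P M} = ⋃ g ∈ (R' : Set K), Orb g := by
    ext M
    simp only [Set.mem_setOf_eq, Set.mem_iUnion, hOrb, hR', Finset.coe_filter, exists_prop]
    constructor
    · rintro ⟨⟨x, ζ, y'', hx, hζ, hy'', rfl, hstab, hdual⟩, hPM⟩
      obtain ⟨V, hV⟩ := exists_gl_coe_eq_glued x ζ y'' (pow_ne_zero ρ hϖ0) (pow_ne_zero _ hϖ0)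
      rw [← hV] at hdual
      obtain ⟨f, hσf, hκf⟩ := (isDualisableLattice_latt_glued_iff_exists_fixed_kappa hσ hvσ hϖ0 hϖ1 hTr ρ t hρ ht hx hζ hy'' V hV).1 hdual
      have hvκ : Valued.v (y'' / (x * ζ)) = Valued.v ϖ ^ (2 * t) := by rw [map_div₀, map_mul, hx, hζ, mul_one, div_one, hy'']
      have hvf : Valued.v f = Valued.v ϖ ^ (2 * t) := by
        have h := Valuation.map_sub_eq_of_lt_left Valued.v (hvκ ▸ hκf.trans_lt hlt : Valued.v (y'' / (x * ζ) - f) < Valued.v (y'' / (x * ζ)))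
        rw [← hvκ, ← h, sub_sub_cancel]
      obtain ⟨g, hg, hfg⟩ := hR2 f hσf hvf
      have hκg : Valued.v (y'' / (x * ζ) - g) ≤ Valued.v ϖ ^ (ρ + 2 * t) := by
        rw [show y'' / (x * ζ) - g = (y'' / (x * ζ) - f) + (f - g) by ring]
        exact Valuation.map_add_le _ hκf hfg
      obtain ⟨u, hu, hM⟩ := exists_mem_unitTorus_latt_glued_eq_mapGL hϖ0 ρ t hx hζ hy'' ht hϖ1 (hvg g hg) hκg (V₀ g) (hV₀ g)
      refine ⟨g, ⟨hg, ?_, ?_⟩, u, hu, hM⟩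
      · -- the representative is stable because its translate `M` is
        rw [hM] at hstab
        exact (mapGL_mapGL_diagGLUnits_eq_iff u T hT _).1 hstab
      · -- the representative is in the cut because its translate `M` is
        rw [hM] at hPM
        exact (hP u hu _).1 hPM
    · rintro ⟨g, ⟨hg, hgst, hgP⟩, u, hu, rfl⟩
      obtain ⟨x', ζ', y₁, hx', hζ', hy₁, hκ, hM⟩ := exists_glued_of_mem_orbit u hu g (ϖ ^ ρ) (ϖ ^ (2 * ρ + 2 * t)) (V₀ g) (hV₀ g)
      have hy₁' : Valued.v y₁ = Valued.v ϖ ^ (2 * t) := by rw [hy₁, (hR1 g hg).2]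
      obtain ⟨V, hV⟩ := exists_gl_coe_eq_glued x' ζ' y₁ (pow_ne_zero ρ hϖ0) (pow_ne_zero _ hϖ0)
      refine ⟨⟨x', ζ', y₁, hx', hζ', hy₁', hM, ?_, ?_⟩, (hP u hu _).2 hgP⟩
      · exact (mapGL_mapGL_diagGLUnits_eq_iff u T hT _).2 hgst
      · rw [hM, ← hV]
        exact (isDualisableLattice_latt_glued_iff_exists_fixed_kappa hσ hvσ hϖ0 hϖ1 hTr ρ t hρ ht hx' hζ' hy₁' V hV).2
          ⟨g, (hR1 g hg).1, by rw [hκ, sub_self, map_zero]; exact zero_le⟩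
  -- pairwise disjoint orbits
  have hdisj : (R' : Set K).PairwiseDisjoint Orb := by
    intro g hg g' hg' hne
    have hgR : g ∈ R := (Finset.mem_filter.1 hg).1
    have hg'R : g' ∈ R := (Finset.mem_filter.1 hg').1
    rw [Function.onFun, Set.disjoint_left]
    intro M hM hM'
    apply hne
    simp only [hOrb, Set.mem_setOf_eq] at hM hM'
    obtain ⟨u, hu, rfl⟩ := hM
    obtain ⟨u', hu', hMM⟩ := hM'
    obtain ⟨x, ζ, y, hx, hζ, hy, hκ, h1⟩ := exists_glued_of_mem_orbit u hu g (ϖ ^ ρ) (ϖ ^ (2 * ρ + 2 * t)) (V₀ g) (hV₀ g)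
    obtain ⟨x', ζ', y', hx', hζ', -, hκ', h2⟩ := exists_glued_of_mem_orbit u' hu' g' (ϖ ^ ρ) (ϖ ^ (2 * ρ + 2 * t)) (V₀ g') (hV₀ g')
    have hyv : Valued.v y = Valued.v ϖ ^ (2 * t) := by rw [hy, (hR1 g hgR).2]
    have hv := v_kappa_sub_le_of_latt_glued_eq hϖ0 hϖ1.le ρ t hx hζ hyv hx' hζ' (h1.symm.trans (hMM.trans h2))
    rw [hκ, hκ'] at hv
    exact hR3 g hgR g' hg'R hv
  -- orbit sizes, and the summand along an orbit
  have hN : ∀ g ∈ (R' : Set K), (Orb g).ncard = ((Nat.card 𝓀[K] - 1) * Nat.card 𝓀[K] ^ (ρ + 2 * t - 1)) * ((Nat.card 𝓀[K] - 1) * Nat.card 𝓀[K] ^ (2 * ρ - 1)) :=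
    fun g hg => ncard_unitTorus_orbit_latt_glued_eq hϖ hρ (2 * t) h11 h11 (by rw [(hR1 g (Finset.mem_filter.1 hg).1).2]) (V₀ g) (by rw [hV₀ g])
  have hq : 1 < Nat.card 𝓀[K] := Finite.one_lt_card
  have hN0 : ((Nat.card 𝓀[K] - 1) * Nat.card 𝓀[K] ^ (ρ + 2 * t - 1)) * ((Nat.card 𝓀[K] - 1) * Nat.card 𝓀[K] ^ (2 * ρ - 1)) ≠ 0 :=
    mul_ne_zero (mul_ne_zero (by omega) (pow_ne_zero _ (by omega))) (mul_ne_zero (by omega) (pow_ne_zero _ (by omega)))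
  have hfinOrb : ∀ g ∈ (R' : Set K), (Orb g).Finite := fun g hg => Set.finite_of_ncard_ne_zero (by rw [hN g hg]; exact hN0)
  have hw : ∀ g ∈ (R' : Set K), ∀ M ∈ Orb g,
      (labelledOddCount σ ϖ tv i Λ M : ℚ) / ((((unitStabilizer M).map (unitNormMap σ 3)).relIndex (fixedUnitTorus σ 3) : ℕ) : ℚ) =
        (labelledOddCount σ ϖ tv i Λ (latt (V₀ g : Matrix (Fin 3) (Fin 3) K)) : ℚ) /
          ((((unitStabilizer (latt (V₀ g : Matrix (Fin 3) (Fin 3) K))).map (unitNormMap σ 3)).relIndex (fixedUnitTorus σ 3) : ℕ) : ℚ) := by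
    rintro g - M ⟨u, -, rfl⟩
    rw [labelledOddCount_mapGL_diagGLUnits hσ ϖ tv i hΛ, unitStabilizer_mapGL_diagGLUnits]
  have hR'fin : (R' : Set K).Finite := R'.finite_toSet
  rw [hset, finsum_mem_biUnion hdisj hR'fin hfinOrb,
    finsum_mem_congr rfl (fun g hg => finsum_mem_eq_ncard_mul (hfinOrb g hg) _ _ (hw g hg)),
    finsum_mem_congr rfl (fun g hg => by rw [hN g hg]), finsum_mem_coe_finset, Finset.mul_sum]

end Summit.HodgeConjecture.HodgeConjecture.Cruxes.H413.F0P3cDyRamLabelledOddGluedDecomposition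

end
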